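import Mathlib

/-!
# A good common value from a lower bound on `Σ μXY` and an upper bound on `Σ XY`

Crux `Summit.MatrixMultiplication.MatrixMultiplication.Theses.SnSubsetDichotomy.PolynomialSlack`
(item `stmt-MatrixMultiplication-8306`), level-one programme, lead c7 (dyadic hub lemma, selection step).

Given a sub-probability vector `μ` on a finite type and nonnegative profiles `X, Y` with
`Σ μXY ≥ 2q` (`q > 0`) and `Σ XY ≤ Z` (`Z > 0`), some index `v` carries `μ(v)X(v)Y(v) ≥ q²/Z`
(`exists_good_value_of_sum`).

Proof. Let `m := max_v μXY`. Pointwise `μXY ≤ (m/q)·XY + q·μ` (if `XY ≥ q` then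
`μXY ≤ m ≤ m·XY/q`; otherwise `μXY ≤ μ q`), and summing, `2q ≤ Σ μXY ≤ (m/q) Z + q Σμ ≤ (m/q) Z + q`,
i.e. `q² ≤ m Z`, `m ≥ q²/Z`.
-/

namespace Summit.MatrixMultiplication.MatrixMultiplication.Theorems.PolynomialSlack

set_option linter.dupNamespace false

open scoped BigOperators

/-- **Good value.** For `μ, X, Y ≥ 0` on a finite type with `Σ μ ≤ 1`, `Σ μXY ≥ 2q` (`q > 0`) and `Σ XY ≤ Z`
(`Z > 0`), some `v` has `μ(v)X(v)Y(v) ≥ q²/Z`: with `m = max μXY`, the indices with `XY < q` contribute `≤ q·Σμ ≤ q`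
to `Σ μXY` and the others number `≤ Z/q` and contribute `≤ m` each (implemented through the pointwise bound
`μXY ≤ (m/q)·XY + q·μ`). [folklore] -/
theorem exists_good_value_of_sum {ι : Type*} [Fintype ι] (μ X Y : ι → ℝ) (q Z : ℝ)
    (hμ0 : ∀ v, 0 ≤ μ v) (hμ1 : ∑ v, μ v ≤ 1) (hX0 : ∀ v, 0 ≤ X v) (hY0 : ∀ v, 0 ≤ Y v)
    (hq : 0 < q) (hZ : 0 < Z) (hsum : 2 * q ≤ ∑ v, μ v * X v * Y v) (hforced : ∑ v, X v * Y v ≤ Z) :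
    ∃ v, q ^ 2 / Z ≤ μ v * X v * Y v := by
  classical
  -- the index type is nonempty, as otherwise `Σ μXY = 0 < 2q`
  have hne : (Finset.univ : Finset ι).Nonempty := by
    by_contra h
    rw [Finset.not_nonempty_iff_eq_empty] at h
    rw [h, Finset.sum_empty] at hsum
    linarith
  -- a maximiser `v₀` of `μ X Y`, with maximum `m`
  obtain ⟨v₀, -, hv₀⟩ := Finset.exists_max_image Finset.univ (fun v => μ v * X v * Y v) hne
  refine ⟨v₀, ?_⟩
  set m : ℝ := μ v₀ * X v₀ * Y v₀ with hm_def
  have hm : ∀ v, μ v * X v * Y v ≤ m := fun v => hv₀ v (Finset.mem_univ v)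
  have hm0 : 0 ≤ m := mul_nonneg (mul_nonneg (hμ0 v₀) (hX0 v₀)) (hY0 v₀)
  have hqne : q ≠ 0 := hq.ne'
  -- pointwise: `μXY ≤ (m/q)·XY + q·μ`
  have hpt : ∀ v, μ v * X v * Y v ≤ m / q * (X v * Y v) + q * μ v := by
    intro v
    have hXY0 : 0 ≤ X v * Y v := mul_nonneg (hX0 v) (hY0 v)
    rcases le_or_gt q (X v * Y v) with h | h
    · have h1 : μ v * X v * Y v ≤ m := hm v
      have h2 : m ≤ m / q * (X v * Y v) := by
        rw [div_mul_eq_mul_div, le_div_iff₀ hq]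
        exact mul_le_mul_of_nonneg_left h hm0
      have h3 : 0 ≤ q * μ v := mul_nonneg hq.le (hμ0 v)
      linarith
    · have h1 : μ v * X v * Y v ≤ q * μ v := by
        rw [mul_assoc, mul_comm q]
        exact mul_le_mul_of_nonneg_left h.le (hμ0 v)
      have h2 : 0 ≤ m / q * (X v * Y v) := mul_nonneg (div_nonneg hm0 hq.le) hXY0
      linarith
  -- upper bound: `Σ μXY ≤ (m/q) Z + q`
  have hup : ∑ v, μ v * X v * Y v ≤ m / q * Z + q := by
    calc ∑ v, μ v * X v * Y v ≤ ∑ v, (m / q * (X v * Y v) + q * μ v) :=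
          Finset.sum_le_sum fun v _ => hpt v
      _ = m / q * ∑ v, X v * Y v + q * ∑ v, μ v := by
          rw [Finset.sum_add_distrib, Finset.mul_sum, Finset.mul_sum]
      _ ≤ m / q * Z + q := by
          have h1 : m / q * ∑ v, X v * Y v ≤ m / q * Z :=
            mul_le_mul_of_nonneg_left hforced (div_nonneg hm0 hq.le)
          have h2 : q * ∑ v, μ v ≤ q := by
            calc q * ∑ v, μ v ≤ q * 1 := mul_le_mul_of_nonneg_left hμ1 hq.le
              _ = q := mul_one q
          linarith
  -- combine: `q² ≤ m Z`
  have hkey : q ^ 2 ≤ m * Z := by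
    have h1 : q ≤ m / q * Z := by linarith
    calc q ^ 2 = q * q := sq q
      _ ≤ q * (m / q * Z) := mul_le_mul_of_nonneg_left h1 hq.le
      _ = m * Z := by field_simp
  -- conclude: `q²/Z ≤ m`
  rw [div_le_iff₀ hZ]
  exact hkey

end Summit.MatrixMultiplication.MatrixMultiplication.Theorems.PolynomialSlack
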